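import Mathlib
import HarnessLib
import Summits.NavierStokesRegularity.NavierStokesRegularity.Theorems.HalfSpaceWindowDoorCirculationCarryingRigidityLedger
import Summits.NavierStokesRegularity.NavierStokesRegularity.Theorems.PoloidalWindowDoorPoloidalWindowRigidityClassSpaceTimeRates
import Summits.NavierStokesRegularity.NavierStokesRegularity.Theorems.AxisTwistDoorAveragedConeLiouvilleCylFrame
import Summits.NavierStokesRegularity.NavierStokesRegularity.Theorems.AxisTwistDoorAveragedConeLiouvilleCircleStokes

/-!
# Route `HalfSpaceWindowDoor`, crux `CirculationCarryingRigidity` (stmt-NavierStokesRegularity-25311) — line `ledger`, Step 3: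
# the SUBLINEAR CIRCULATION LAW `Γ(ρ,c,s) ≲ (ρ²/(−s))^{1/3}` — the mean swirl of a closed-hemisphere door-class profile DECAYS
# at horizontal infinity

LEAD ns-hsw-p1 g12 (cell pub-ns-dss), `--supports stmt-NavierStokesRegularity-25311 --as helper`.

THE POINT.  In the route's time-only Type-I class the only a-priori bounds on the disc circulation `Γ(ρ,c,s) = ∮_{S(ρ,c)} v·e_θ dl`
about a vertical axis were LINEAR in the radius — Stokes, `Γ ≤ 2πρ·C/√(−s)` (the mean swirl `v̄_θ = Γ/(2πρ) ≤ C/√(−s)` does not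
decay), and the gradient bound `Γ ≤ πρ²K₁/(−s)` — and the residual enemies of the time-only rows (`…TimeOnly*`: «mean inflow
`r v̄_r < −1` at radii `r ≳ √(−s)/C`», `…AnnularMean`: the point-vortex / Mestel far field) live exactly at horizontal infinity.
The far-past energy ledger (`…Ledger.exists_ledger`, from the tree theorem `Theorems.FarPastLedger_proof`) and the
closed-hemisphere sign give a POINTWISE SUBLINEAR law:

* `exists_fderiv_rate` — the uniform gradient rate of the door class, `‖Dv(t)‖ ≤ K₁(C)/(−t)` (tree
  `…ClassSpaceTimeRates.exists_spaceTime_rate_of_class`, one constant per `C`);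
* `abs_circ_sub_circ_le` — HEIGHT-LIPSCHITZ circulation: `|Γ(ρ,z₁,s) − Γ(ρ,z₂,s)| ≤ 2πρ·L·|z₁ − z₂|` whenever `‖Dv(s)‖ ≤ L`
  (mean-value inequality on the vertical segments of the cylinder);
* `circ_cube_le_or_sq_le` — **THE SUBLINEAR LAW**: for every closed-hemisphere door-class profile, every axis (here `e₃`; translate
  by `…MovingFrame.inDoorClass_translate`), `s < 0`, `ρ > 0`, `z`:
  `Γ(ρ,z,s)³ ≤ 32π²e · K(C)K₁(C) · ρ²/(−s)`   or   `Γ(ρ,z,s)² ≤ 8π K(C)`.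
  MECHANISM: if `Γ(ρ,z₁,s) = γ`, height-Lipschitz keeps `Γ(ρ,·,s) ≥ γ/2` on a window of half-width `δ ≍ γ(−s)/(ρK₁)` around
  `z₁` (and `Γ(r,·,s) ≥ γ/2` there for all `r ≥ ρ` by monotonicity), so the rms law of `…Ledger` on the window of half-width
  `max(δ, eρ)` reads `γ²δ ≲ K·max(δ, eρ)`: either `γ² ≲ K` or `γ³ ≲ K K₁ ρ²/(−s)`.
* `circ_le_rpow_of_far` — FAR-FIELD FORM: for `ρ² ≥ −s`, `Γ(ρ,z,s) ≤ A(C) · (ρ²/(−s))^{1/3}` with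
  `A = (8πK)^{1/2} + (32π²e K K₁)^{1/3}`; equivalently the MEAN SWIRL obeys `v̄_θ(ρ,z,s) ≤ A(C)/(2π) · ρ^{−1/3}(−s)^{−1/3}`:
  it DECAYS at horizontal infinity, uniformly in the height, for every profile of the class (scale-invariantly:
  `√(−s)·v̄_θ ≲ (ρ/√(−s))^{−1/3}`).

CENSUS READING.  The «Rankine / Mestel» far fields (`v̄_θ → const > 0` along some sequence of radii on some plane), alive under every
time-only row so far, are DEAD pointwise — on every plane, at every time, about every axis.  The enemy of W6 carries circulation
`o(ρ)` — at most `ρ^{2/3}` — through large circles; its plane flux `Φ(c,s) = lim_ρ Γ` may still be infinite, but only with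
growth `≤ ρ^{2/3}`.  (Line `ledger`, Steps 1–2: `…LogEnergy`, `…Ledger` — rms law, tube pinching, no columnar vortex.)

WHAT THIS IS NOT: not a statement about Navier–Stokes regularity (Clay A); door statements are regularity CRITERIA about
HYPOTHETICAL blow-up profiles (KNSS ancient mild solutions); item 25311 stays OPEN at its research stub `stub_layerExclusion`.
-/

noncomputable section

-- the summit and its single sub-problem share the name (CONVENTIONS §1), as in every Theorems file
set_option linter.dupNamespace false

namespace Summit.NavierStokesRegularity.NavierStokesRegularity.Theorems.HalfSpaceWindowDoorCirculationCarryingRigidityLedgerSublinear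

open Set Function Filter MeasureTheory Topology intervalIntegral Metric
open scoped InnerProductSpace RealInnerProductSpace
open Literature.Analysis Literature.Analysis.FluidPDE
open Summit.NavierStokesRegularity.NavierStokesRegularity.Theorems.HalfSpaceWindowDoorCirculationCarryingRigidityDefs (InDoorClass)
open Summit.NavierStokesRegularity.NavierStokesRegularity.Theorems.AxisTwistDoorAveragedConeLiouvilleDefs (cylPt eR eT e3 circ SignE3)
open Summit.NavierStokesRegularity.NavierStokesRegularity.Theorems.AveragedConeLiouville.CircMonotone (circ_nonneg circ_mono)
open Summit.NavierStokesRegularity.NavierStokesRegularity.Theorems.HalfSpaceWindowDoorCirculationCarryingRigidityConeFluxSubsolution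
  (contDiff_one_slice)
open Summit.NavierStokesRegularity.NavierStokesRegularity.Theorems.PoloidalWindowDoorPoloidalWindowRigidityClassSpaceTimeRates
  (exists_spaceTime_rate_of_class)
open Summit.NavierStokesRegularity.NavierStokesRegularity.Theorems.AxisTwistDoorAveragedConeLiouvilleCylFrame
  (abs_inner_eT_le continuous_cylPt_θ)
open Summit.NavierStokesRegularity.NavierStokesRegularity.Theorems.AveragedConeLiouville.CircleStokes (cylPt_eq_smul_eR continuous_eT)
open Summit.NavierStokesRegularity.NavierStokesRegularity.Theorems.HalfSpaceWindowDoorCirculationCarryingRigidityPlanarEnergy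
  (continuous_circ_height)
open Summit.NavierStokesRegularity.NavierStokesRegularity.Theorems.HalfSpaceWindowDoorCirculationCarryingRigidityLogEnergy
  (circ_sq_integral_mul_log_le mul_le_integral_circ_sq)
open Summit.NavierStokesRegularity.NavierStokesRegularity.Theorems.HalfSpaceWindowDoorCirculationCarryingRigidityLedger
  (exists_ledger)

variable {v : ℝ → EuclideanSpace ℝ (Fin 3) → EuclideanSpace ℝ (Fin 3)}

/-! ### The uniform gradient rate of the door class -/

/-- **Uniform gradient rate**: one `K₁ = K₁(C) ≥ 0` with `‖Dv(t)(y)‖ ≤ K₁/(−t)` for every door-class profile with constant `C`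
(tree `…ClassSpaceTimeRates.exists_spaceTime_rate_of_class` with `(k,l) = (1,0)`). -/
theorem exists_fderiv_rate (C : ℝ) : ∃ K₁ : ℝ, 0 ≤ K₁ ∧
    ∀ v : ℝ → EuclideanSpace ℝ (Fin 3) → EuclideanSpace ℝ (Fin 3), InDoorClass C v →
      ∀ t < 0, ∀ y, ‖fderiv ℝ (v t) y‖ ≤ K₁ / (-t) := by
  obtain ⟨K, hK0, hK⟩ := exists_spaceTime_rate_of_class C 1 0
  refine ⟨K, hK0, fun v hv t ht y => ?_⟩
  have h := hK v hv.1 hv.2.1 hv.2.2.1 t ht y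
  have hid : (fun y' => iteratedDeriv 0 (fun τ => v τ y') t) = v t := by
    funext y'; rw [iteratedDeriv_zero]
  rw [hid, norm_iteratedFDeriv_one (𝕜 := ℝ)] at h
  have h2 : Real.sqrt (-t) ^ (1 + 2 * 0 + 1) = -t := by
    rw [show 1 + 2 * 0 + 1 = 2 by norm_num, Real.sq_sqrt (neg_pos.2 ht).le]
  rwa [h2] at h

/-! ### Height-Lipschitz circulation -/

/-- Two points of a vertical line of the cylinder: `cylPt ρ θ z₁ − cylPt ρ θ z₂ = (z₁ − z₂) • e₃`. -/
theorem cylPt_sub_cylPt (ρ θ z₁ z₂ : ℝ) : cylPt ρ θ z₁ - cylPt ρ θ z₂ = (z₁ - z₂) • e3 := by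
  rw [cylPt_eq_smul_eR, cylPt_eq_smul_eR, sub_smul]
  abel

/-- **HEIGHT-LIPSCHITZ CIRCULATION.**  If `‖Dv(s)(y)‖ ≤ L` everywhere, then for `ρ ≥ 0`:
`|Γ(ρ,z₁,s) − Γ(ρ,z₂,s)| ≤ 2πρ · L · |z₁ − z₂|`. -/
theorem abs_circ_sub_circ_le {s ρ z₁ z₂ L : ℝ} (hρ : 0 ≤ ρ) (hv1 : ContDiff ℝ 1 (v s))
    (hL : ∀ y, ‖fderiv ℝ (v s) y‖ ≤ L) :
    |circ v ρ z₁ s - circ v ρ z₂ s| ≤ 2 * Real.pi * ρ * L * |z₁ - z₂| := by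
  have hvd : ∀ y ∈ (univ : Set (EuclideanSpace ℝ (Fin 3))), DifferentiableAt ℝ (v s) y :=
    fun y _ => (hv1.differentiable one_ne_zero) y
  have hvc : Continuous (v s) := hv1.continuous
  have hmvt : ∀ θ : ℝ, ‖v s (cylPt ρ θ z₁) - v s (cylPt ρ θ z₂)‖ ≤ L * |z₁ - z₂| := by
    intro θ
    have h := Convex.norm_image_sub_le_of_norm_fderiv_le (f := v s) hvd (fun y _ => hL y) convex_univ
      (mem_univ (cylPt ρ θ z₂)) (mem_univ (cylPt ρ θ z₁))
    have he3 : ‖e3‖ = 1 := by simp [e3]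
    rw [cylPt_sub_cylPt, norm_smul, he3, mul_one, Real.norm_eq_abs] at h
    exact h
  have h2π : (0 : ℝ) ≤ 2 * Real.pi := by positivity
  unfold circ
  rw [← intervalIntegral.integral_sub
    ((((hvc.comp (continuous_cylPt_θ ρ z₁)).inner continuous_eT).mul continuous_const).intervalIntegrable _ _)
    ((((hvc.comp (continuous_cylPt_θ ρ z₂)).inner continuous_eT).mul continuous_const).intervalIntegrable _ _)]
  have hpt : ∀ θ ∈ Set.uIoc (0 : ℝ) (2 * Real.pi),
      ‖⟪v s (cylPt ρ θ z₁), eT θ⟫_ℝ * ρ - ⟪v s (cylPt ρ θ z₂), eT θ⟫_ℝ * ρ‖ ≤ ρ * (L * |z₁ - z₂|) := by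
    intro θ _
    rw [← sub_mul, ← inner_sub_left, norm_mul, Real.norm_eq_abs, Real.norm_eq_abs, abs_of_nonneg hρ, mul_comm]
    exact mul_le_mul_of_nonneg_left ((abs_inner_eT_le _ θ).trans (hmvt θ)) hρ
  have h := intervalIntegral.norm_integral_le_of_norm_le_const hpt
  rw [Real.norm_eq_abs, sub_zero, abs_of_nonneg h2π] at h
  calc |(∫ θ in (0 : ℝ)..(2 * Real.pi), ⟪v s (cylPt ρ θ z₁), eT θ⟫_ℝ * ρ - ⟪v s (cylPt ρ θ z₂), eT θ⟫_ℝ * ρ)|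
      ≤ ρ * (L * |z₁ - z₂|) * (2 * Real.pi) := h
    _ = 2 * Real.pi * ρ * L * |z₁ - z₂| := by ring

/-! ### The sublinear law -/

/-- **THE SUBLINEAR CIRCULATION LAW (one slice).**  Let `v(s)` (`s < 0`) be a `C¹` slice with `ω₃ ≥ 0`, gradient bound
`‖Dv(s)‖ ≤ K₁/(−s)` and the Leray-rate energy ledger `∫_{B_r(x₀)}‖v(s)‖² ≤ K r` (`K, K₁ ≥ 0`).  Then for every `ρ > 0` and `z`:
`Γ(ρ,z,s)³ ≤ 32π²e·K K₁·ρ²/(−s)` or `Γ(ρ,z,s)² ≤ 8πK`. -/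
theorem circ_cube_le_or_sq_le_of_ledger {s : ℝ} (hs : s < 0) (hv1 : ContDiff ℝ 1 (v s)) (hsign : SignE3 v)
    {K K₁ : ℝ} (hK0 : 0 ≤ K) (hK₁0 : 0 ≤ K₁)
    (hK : ∀ (x₀ : EuclideanSpace ℝ (Fin 3)) (r : ℝ), 0 < r → ∫ x in ball x₀ r, ‖v s x‖ ^ 2 ≤ K * r)
    (hK₁ : ∀ y, ‖fderiv ℝ (v s) y‖ ≤ K₁ / (-s)) {ρ : ℝ} (hρ : 0 < ρ) (z : ℝ) :
    circ v ρ z s ^ 3 ≤ 32 * Real.pi ^ 2 * Real.exp 1 * K * K₁ * ρ ^ 2 / (-s) ∨ circ v ρ z s ^ 2 ≤ 8 * Real.pi * K := by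
  have hs' : 0 < -s := neg_pos.2 hs
  set γ : ℝ := circ v ρ z s with hγ
  have hγ0 : 0 ≤ γ := circ_nonneg v hv1 hsign hs hρ.le z
  rcases hγ0.eq_or_lt with hγz | hγpos
  · right; rw [← hγz, zero_pow two_ne_zero]; positivity
  -- Lipschitz constant in the height, enlarged so that the window fits in `(z − eρ, z + eρ)`
  set Λ : ℝ := 2 * Real.pi * ρ * (K₁ / (-s)) with hΛ
  have hΛ0 : 0 ≤ Λ := by positivity
  set Λ' : ℝ := max Λ (γ / (2 * (Real.exp 1 * ρ))) with hΛ'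
  have heρ : 0 < Real.exp 1 * ρ := by positivity
  have hΛ'pos : 0 < Λ' := lt_of_lt_of_le (div_pos hγpos (by positivity)) (le_max_right _ _)
  set δ : ℝ := γ / (2 * Λ') with hδ
  have hδpos : 0 < δ := div_pos hγpos (mul_pos two_pos hΛ'pos)
  have hδle : δ ≤ Real.exp 1 * ρ := by
    rw [hδ, div_le_iff₀ (by positivity)]
    have : γ / (2 * (Real.exp 1 * ρ)) ≤ Λ' := le_max_right _ _
    rw [div_le_iff₀ (by positivity)] at this
    linarith
  -- `Γ(ρ, c, s) ≥ γ/2` on the window `|c − z| < δ`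
  have hwin : ∀ c ∈ Ioo (z - δ) (z + δ), γ / 2 ≤ circ v ρ c s := by
    intro c hc
    have hlip := abs_circ_sub_circ_le (z₁ := z) (z₂ := c) hρ.le hv1 hK₁
    have hcz : |z - c| < δ := abs_lt.2 ⟨by linarith [hc.2], by linarith [hc.1]⟩
    have h1 : |γ - circ v ρ c s| ≤ Λ' * δ := by
      calc |γ - circ v ρ c s| ≤ 2 * Real.pi * ρ * (K₁ / (-s)) * |z - c| := hlip
        _ ≤ Λ' * |z - c| := mul_le_mul_of_nonneg_right (le_max_left _ _) (abs_nonneg _)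
        _ ≤ Λ' * δ := mul_le_mul_of_nonneg_left hcz.le hΛ'pos.le
    have h2 : Λ' * δ = γ / 2 := by rw [hδ]; field_simp
    rw [h2] at h1
    linarith [(abs_sub_lt_iff.1 (lt_of_le_of_lt h1 (by linarith : γ / 2 < γ))).1, le_abs_self (γ - circ v ρ c s)]
  -- rms law on the window of half-width `R = eρ` (so `log(R/ρ) = 1`)
  set R : ℝ := Real.exp 1 * ρ with hR
  have hρR : ρ < R := by
    have : 1 < Real.exp 1 := Real.one_lt_exp_iff.2 one_pos
    calc ρ = 1 * ρ := (one_mul ρ).symm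
      _ < Real.exp 1 * ρ := mul_lt_mul_of_pos_right this hρ
  have hlog : Real.log (R / ρ) = 1 := by
    rw [hR, mul_div_assoc, div_self hρ.ne', mul_one, Real.log_exp]
  have hmain := circ_sq_integral_mul_log_le hs hv1 hsign hK hρ hρR z
  rw [hlog, mul_one] at hmain
  -- lower bound of the window integral by the `δ`-sub-window
  have hsub : (γ / 2) ^ 2 * (z + δ - (z - δ)) ≤ ∫ c in Ioo (z - δ) (z + δ), circ v ρ c s ^ 2 :=
    mul_le_integral_circ_sq hv1.continuous (by linarith) (by positivity) hwin
  have hmono : ∫ c in Ioo (z - δ) (z + δ), circ v ρ c s ^ 2 ≤ ∫ c in Ioo (z - R) (z + R), circ v ρ c s ^ 2 :=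
    setIntegral_mono_set
      ((((continuous_circ_height hv1.continuous ρ).pow 2).continuousOn.integrableOn_compact isCompact_Icc).mono_set
        Ioo_subset_Icc_self)
      (Eventually.of_forall fun c => sq_nonneg _)
      (Eventually.of_forall (Ioo_subset_Ioo (by linarith) (by linarith)))
  have hkey : γ ^ 2 * δ ≤ 8 * Real.pi * K * R := by
    have e1 : (γ / 2) ^ 2 * (z + δ - (z - δ)) = γ ^ 2 * δ / 2 := by ring
    rw [e1] at hsub
    linarith [hsub.trans (hmono.trans hmain)]
  -- `δ = γ/(2Λ')`: either `Λ' = Λ` or `Λ' = γ/(2eρ)`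
  rcases le_total Λ (γ / (2 * (Real.exp 1 * ρ))) with hcase | hcase
  · -- `Λ' = γ/(2eρ)`, `δ = eρ`: `γ² eρ ≤ 8πK eρ`
    right
    have hΛ'eq : Λ' = γ / (2 * (Real.exp 1 * ρ)) := max_eq_right hcase
    have hδeq : δ = Real.exp 1 * ρ := by rw [hδ, hΛ'eq]; field_simp
    rw [hδeq, hR] at hkey
    exact le_of_mul_le_mul_right (by linarith) heρ
  · -- `Λ' = Λ`, `δ = γ/(2Λ)`: `γ³ ≤ 16πe K ρ Λ = 32π²e K K₁ ρ²/(−s)`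
    left
    have hΛ'eq : Λ' = Λ := max_eq_left hcase
    have hΛpos : 0 < Λ := hΛ'eq ▸ hΛ'pos
    have hδeq : δ = γ / (2 * Λ) := by rw [hδ, hΛ'eq]
    rw [hδeq, hR] at hkey
    -- γ² · γ/(2Λ) ≤ 8πK eρ  ⇒  γ³ ≤ 16 π e K ρ Λ
    have h3 : γ ^ 3 ≤ 16 * Real.pi * Real.exp 1 * K * ρ * Λ := by
      have := mul_le_mul_of_nonneg_right hkey (by positivity : (0 : ℝ) ≤ 2 * Λ)
      have e2 : γ ^ 2 * (γ / (2 * Λ)) * (2 * Λ) = γ ^ 3 := by field_simp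
      rw [e2] at this
      linarith
    have e3 : 16 * Real.pi * Real.exp 1 * K * ρ * Λ = 32 * Real.pi ^ 2 * Real.exp 1 * K * K₁ * ρ ^ 2 / (-s) := by
      rw [hΛ]; field_simp; ring
    linarith [e3]

/-- **THE SUBLINEAR CIRCULATION LAW (door class + closed hemisphere).**  For every Type-I constant `C` there are
`K = K(C), K₁ = K₁(C) ≥ 0` (the ledger and gradient constants of the class) such that every closed-hemisphere door-class profile
satisfies, for all `s < 0`, `ρ > 0`, `z`:  `Γ(ρ,z,s)³ ≤ 32π²e·K K₁·ρ²/(−s)`  or  `Γ(ρ,z,s)² ≤ 8πK`. -/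
theorem exists_circ_cube_le_or_sq_le (C : ℝ) : ∃ K K₁ : ℝ, 0 ≤ K ∧ 0 ≤ K₁ ∧
    ∀ v : ℝ → EuclideanSpace ℝ (Fin 3) → EuclideanSpace ℝ (Fin 3), InDoorClass C v → SignE3 v →
      ∀ s < 0, ∀ ρ > 0, ∀ z : ℝ,
        circ v ρ z s ^ 3 ≤ 32 * Real.pi ^ 2 * Real.exp 1 * K * K₁ * ρ ^ 2 / (-s) ∨ circ v ρ z s ^ 2 ≤ 8 * Real.pi * K := by
  obtain ⟨K, hK0, hK⟩ := exists_ledger C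
  obtain ⟨K₁, hK₁0, hK₁⟩ := exists_fderiv_rate C
  exact ⟨K, K₁, hK0, hK₁0, fun v hv hsign s hs ρ hρ z =>
    circ_cube_le_or_sq_le_of_ledger hs (contDiff_one_slice hv hs) hsign hK0 hK₁0 (fun x₀ r hr => hK v hv s hs x₀ r hr)
      (hK₁ v hv s hs) hρ z⟩

/-- From `γ ≥ 0`, `γ³ ≤ X` conclude `γ ≤ X^{1/3}`. -/
theorem le_rpow_third_of_pow_three_le {γ X : ℝ} (hγ : 0 ≤ γ) (h : γ ^ 3 ≤ X) : γ ≤ X ^ ((1 : ℝ) / 3) := by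
  have hX : 0 ≤ X := (pow_nonneg hγ 3).trans h
  calc γ = (γ ^ 3) ^ ((1 : ℝ) / 3) := by
        rw [← Real.rpow_natCast, ← Real.rpow_mul hγ]; norm_num
    _ ≤ X ^ ((1 : ℝ) / 3) := Real.rpow_le_rpow (pow_nonneg hγ 3) h (by norm_num)

/-- From `γ ≥ 0`, `γ² ≤ X` conclude `γ ≤ √X`. -/
theorem le_sqrt_of_sq_le' {γ X : ℝ} (hγ : 0 ≤ γ) (h : γ ^ 2 ≤ X) : γ ≤ Real.sqrt X := by
  have h' := Real.abs_le_sqrt h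
  rwa [abs_of_nonneg hγ] at h'

/-- **FAR-FIELD FORM: the mean swirl decays.**  With `A = (8πK)^{1/2} + (32π²e K K₁)^{1/3}`: for every closed-hemisphere
door-class profile, all `s < 0`, all FAR radii `ρ² ≥ −s` and all heights,
`Γ(ρ,z,s) ≤ A · (ρ²/(−s))^{1/3}` (`ρ > 0`) — i.e. `v̄_θ = Γ/(2πρ) ≤ (A/2π) · ρ^{−1/3} (−s)^{−1/3}`. -/
theorem exists_circ_le_rpow_of_far (C : ℝ) : ∃ A : ℝ, 0 ≤ A ∧
    ∀ v : ℝ → EuclideanSpace ℝ (Fin 3) → EuclideanSpace ℝ (Fin 3), InDoorClass C v → SignE3 v →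
      ∀ s < 0, ∀ ρ > 0, -s ≤ ρ ^ 2 → ∀ z : ℝ, circ v ρ z s ≤ A * (ρ ^ 2 / (-s)) ^ ((1 : ℝ) / 3) := by
  obtain ⟨K, K₁, hK0, hK₁0, h⟩ := exists_circ_cube_le_or_sq_le C
  set B : ℝ := 32 * Real.pi ^ 2 * Real.exp 1 * K * K₁ with hB
  have hB0 : 0 ≤ B := by positivity
  refine ⟨Real.sqrt (8 * Real.pi * K) + B ^ ((1 : ℝ) / 3), by positivity, fun v hv hsign s hs ρ hρ hρ2 z => ?_⟩
  have hs' : 0 < -s := neg_pos.2 hs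
  have hX : 1 ≤ ρ ^ 2 / (-s) := by rwa [le_div_iff₀ hs', one_mul]
  have hX0 : 0 ≤ ρ ^ 2 / (-s) := by positivity
  have hX3 : 1 ≤ (ρ ^ 2 / (-s)) ^ ((1 : ℝ) / 3) := Real.one_le_rpow hX (by norm_num)
  have hγ0 : 0 ≤ circ v ρ z s := circ_nonneg v (contDiff_one_slice hv hs) hsign hs hρ.le z
  rcases h v hv hsign s hs ρ hρ z with hcube | hsq
  · have h1 : circ v ρ z s ≤ (B * (ρ ^ 2 / (-s))) ^ ((1 : ℝ) / 3) :=
      le_rpow_third_of_pow_three_le hγ0 (by rw [← mul_div_assoc]; exact hcube)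
    rw [Real.mul_rpow hB0 hX0] at h1
    calc circ v ρ z s ≤ B ^ ((1 : ℝ) / 3) * (ρ ^ 2 / (-s)) ^ ((1 : ℝ) / 3) := h1
      _ ≤ (Real.sqrt (8 * Real.pi * K) + B ^ ((1 : ℝ) / 3)) * (ρ ^ 2 / (-s)) ^ ((1 : ℝ) / 3) := by
          gcongr; exact le_add_of_nonneg_left (Real.sqrt_nonneg _)
  · have h1 : circ v ρ z s ≤ Real.sqrt (8 * Real.pi * K) := le_sqrt_of_sq_le' hγ0 hsq
    calc circ v ρ z s ≤ Real.sqrt (8 * Real.pi * K) * 1 := by rw [mul_one]; exact h1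
      _ ≤ (Real.sqrt (8 * Real.pi * K) + B ^ ((1 : ℝ) / 3)) * (ρ ^ 2 / (-s)) ^ ((1 : ℝ) / 3) := by
          gcongr
          exact le_add_of_nonneg_right (by positivity)

end Summit.NavierStokesRegularity.NavierStokesRegularity.Theorems.HalfSpaceWindowDoorCirculationCarryingRigidityLedgerSublinear

end
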